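import Literature.AnabelianGeometry.SemiGraphs.TemperedPiCoverMaps
import Literature.AnabelianGeometry.SemiGraphs.QuotientCovering
import Literature.AnabelianGeometry.SemiGraphs.UniversalCoveringOverProofs

/-!
# The fibre of a quotient `𝒢_{∞,n}/K` as a `π₁^temp(𝒢)`-set ([SemiAnbd] Prop. 3.6 (ii), p. 38)

For Galois level data `D`, a level `n` and a subgroup `K ≤ G_n = Aut(𝒢_{∞,n})`, the quotient
covering `Q = 𝒢_{∞,n}/K` (`QuotientCovering.lean`) is split by `S n`; its fibre over `v₀` is
`K \ G_n` (the automorphism group acts freely and transitively on the fibre of `𝒢_{∞,n}` over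
`v₀`), on which `γ ∈ π₁^temp(𝒢)` acts by `[σ · bp] ↦ [σ ρ_n(γ)⁻¹ · bp]`; in particular
`γ · [bp] = [ρ_n(γ)⁻¹ · bp]` (`piAct_quotBase`).  These quotients realise the transitive objects of
`B^temp(π₁^temp(𝒢))` (essential surjectivity of the fibre functor).
-/

namespace Literature.AnabelianGeometry.SemiGraphs

namespace ProfiniteSemiGraph

open CategoryTheory

universe u

variable {𝒢 : ProfiniteSemiGraph.{u}}

namespace GaloisLevelData

variable (D : GaloisLevelData 𝒢) (h𝒢 : 𝒢.IsCountable) (n : ℕ) (K : Subgroup (D.Gal h𝒢 n))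

/-- The quotient covering `𝒢_{∞,n}/K`. [cite: MochizukiSemiAnbd2006, Prop 3.6(ii) p.38] -/
noncomputable abbrev quotCover : CovObj 𝒢 := (D.cover h𝒢 n).quot K

/-- Its base point `[bp_n]` over `v₀`. [cite: MochizukiSemiAnbd2006, Prop 3.6(ii) p.38] -/
noncomputable def quotBase : ((D.quotCover h𝒢 n K).SV D.v₀).obj.V :=
  (((D.cover h𝒢 n).quotMk K).fV D.v₀).hom.hom (D.bp n)

/-- `S n` splits `𝒢_{∞,n}` (if it splits itself, e.g. if it is point-transitive).
[cite: MochizukiSemiAnbd2006, Prop 3.6 p.38] -/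
theorem splits_cover (hS : (D.S n).Splits (D.S n)) : (D.S n).Splits (D.cover h𝒢 n) :=
  (D.S n).splits_univCoverOver _ h𝒢 hS

/-- `S m` (`m ≥ n`) splits every component object of `𝒢_{∞,n}/K`. [cite: MochizukiSemiAnbd2006, Prop 3.6 p.38] -/
theorem splits_quot_component (hS : (D.S n).Splits (D.S n)) (p : (D.quotCover h𝒢 n K).Point) (m : ℕ)
    (hm : n ≤ m) : (D.S m).Splits ((D.quotCover h𝒢 n K).component p) :=
  D.splits_of_le hm (CovObj.Splits.of_hom_right ((D.quotCover h𝒢 n K).componentι p)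
    (fun _ _ _ hab => Subtype.ext hab) (fun _ _ _ hab => Subtype.ext hab)
    ((D.cover h𝒢 n).splits_quot K (D.splits_cover h𝒢 n hS)))

/-- `𝒢_{∞,n}/K` is tempered, provided `S n` is finite with nonempty fibres.
[cite: MochizukiSemiAnbd2006, Prop 3.6(ii) p.38] -/
theorem quotCover_isTempered (hS : (D.S n).Splits (D.S n)) (hfin : (D.S n).IsFinite)
    (hne : (D.S n).HasNonemptyFibres) : (D.quotCover h𝒢 n K).IsTempered := by
  intro p
  refine ⟨D.S n, hfin, hne, fun q _ => ?_⟩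
  have hs := (D.cover h𝒢 n).splits_quot K (D.splits_cover h𝒢 n hS)
  rcases q with ⟨v, s⟩ | ⟨e, s⟩
  · exact fun x g hgx => hs.1 v x g hgx s
  · exact fun x g hgx => hs.2 e x g hgx s

/-- The universal morphism at `[bp]` is the quotient map. [cite: MochizukiSemiAnbd2006, Prop 3.6(ii) p.38] -/
theorem liftι_quotBase
    (hs : (D.S n).Splits ((D.quotCover h𝒢 n K).component (Sum.inl ⟨D.v₀, D.quotBase h𝒢 n K⟩))) :
    D.liftι h𝒢 (D.quotCover h𝒢 n K) (D.quotBase h𝒢 n K) n hs = (D.cover h𝒢 n).quotMk K := by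
  apply D.hom_ext_bp h𝒢 n
  rw [D.liftι_bp]
  rfl

/-- The level-`n` action on `[bp]`: `σ · [bp] = [σ⁻¹ bp]`. [cite: MochizukiSemiAnbd2006, Prop 3.6(ii) p.38] -/
theorem actAt_quotBase
    (hs : (D.S n).Splits ((D.quotCover h𝒢 n K).component (Sum.inl ⟨D.v₀, D.quotBase h𝒢 n K⟩)))
    (σ : D.Gal h𝒢 n) :
    D.actAt h𝒢 (D.quotCover h𝒢 n K) (D.quotBase h𝒢 n K) n hs σ =
      (((D.cover h𝒢 n).quotMk K).fV D.v₀).hom.hom (((σ⁻¹ : D.Gal h𝒢 n).hom.fV D.v₀).hom.hom (D.bp n)) := by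
  rw [← D.liftι_inv_bp h𝒢 _ _ n hs σ, D.liftι_quotBase h𝒢 n K hs]

/-- The automorphism group acts freely on the fibre of `𝒢_{∞,n}` over `v₀` (rigidity).
[cite: MochizukiSemiAnbd2006, Prop 3.6 p.38] -/
theorem aut_eq_of_apply_bp (σ τ : D.Gal h𝒢 n)
    (h : (σ.hom.fV D.v₀).hom.hom (D.bp n) = (τ.hom.fV D.v₀).hom.hom (D.bp n)) : σ = τ :=
  Aut.ext ((D.S n).univCoverOver_hom_ext _ h𝒢 σ.hom τ.hom (D.bp n) h)

/-- Points `[σ bp]`, `[τ bp]` of the quotient fibre agree iff `τ σ⁻¹ ∈ K`.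
[cite: MochizukiSemiAnbd2006, Prop 3.6(ii) p.38] -/
theorem quotMk_aut_bp_eq_iff (σ τ : D.Gal h𝒢 n) :
    (((D.cover h𝒢 n).quotMk K).fV D.v₀).hom.hom ((σ.hom.fV D.v₀).hom.hom (D.bp n)) =
      (((D.cover h𝒢 n).quotMk K).fV D.v₀).hom.hom ((τ.hom.fV D.v₀).hom.hom (D.bp n)) ↔
      τ * σ⁻¹ ∈ K := by
  rw [CovObj.quotMk_fV_eq_iff]
  constructor
  · rintro ⟨k, hk⟩
    let κ : D.Gal h𝒢 n := k.1
    have e : κ * σ = τ := by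
      apply D.aut_eq_of_apply_bp h𝒢 n
      exact hk
    rw [← e, mul_inv_cancel_right]
    exact k.2
  · intro hK
    refine ⟨⟨τ * σ⁻¹, hK⟩, ?_⟩
    change (((σ.hom ≫ (τ * σ⁻¹ : D.Gal h𝒢 n).hom)).fV D.v₀).hom.hom (D.bp n) = _
    rw [show σ.hom ≫ (τ * σ⁻¹ : D.Gal h𝒢 n).hom = ((τ * σ⁻¹) * σ : D.Gal h𝒢 n).hom from rfl,
      inv_mul_cancel_right]

/-- Every point of the quotient fibre over `v₀` is `[σ bp]` for some `σ ∈ G_n`.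
[cite: MochizukiSemiAnbd2006, Prop 3.6(ii) p.38] -/
theorem exists_quotMk_aut_bp (q : ((D.quotCover h𝒢 n K).SV D.v₀).obj.V) :
    ∃ σ : D.Gal h𝒢 n, (((D.cover h𝒢 n).quotMk K).fV D.v₀).hom.hom ((σ.hom.fV D.v₀).hom.hom (D.bp n)) = q := by
  obtain ⟨u, rfl⟩ := (D.cover h𝒢 n).quotMk_fV_surjective K D.v₀ q
  obtain ⟨η, hη⟩ := (D.S n).exists_aut_apply_eq' h𝒢 (D.W n) (D.htrans n) (D.bp n) u
  exact ⟨η, congrArg (fun z => (((D.cover h𝒢 n).quotMk K).fV D.v₀).hom.hom z) hη⟩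

end GaloisLevelData

end ProfiniteSemiGraph

end Literature.AnabelianGeometry.SemiGraphs
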